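import Literature.AlgebraicGeometry.Resolution.MonoidalTransformStep
import Literature.AlgebraicGeometry.Resolution.DecompositionLayerStrictParameters
import HarnessLib

/-!
# [CoP1] Prop. 8.1 (1): tracking model generators through a step with controlled denominators

Topic: `Literature/AlgebraicGeometry/Resolution`. PROOF side of `CossartPiltant2019ReductionP`
(`ArithmeticalThreefoldsLocal.lean`), input (C4), [CoP1] Prop. 8.1 (V. Cossart, O. Piltant,
HAL hal-00139124, p. 22): property (1), "`(S₀)_f = S_f`", is used in the proof of Prop. 9.3 in
the MODEL reading (`exists_localUniformization_of_head'`, clause (c′): the local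
uniformization is the local ring of a model `S[t′]` with `fⁿ t′ ⊆ R₀`). The printed proof keeps
(1) through each step ("Since `S₀` and `S₁` are birational … there exists `g ∈ m_{S₀}`,
`g ≠ 0` such that `(S₀)_g = (S₁)_g`"; "`S₁ < S₂`, `(S₁)_f = (S₂)_f`"; "Note that property (1)
of the proposition is preserved by this construction"). For the explicit monoidal transforms
this is `MonoidalTransformFrameStepTracked.lean`; the present file is the bookkeeping for an
ARBITRARY step `R_t ⊆ R_{t ∪ P}` whose new generators have CONTROLLED DENOMINATORS: each
`z ∈ P` is `β/α` with `α, β ∈ R_t` and `α ∣ gᴺ` in the new local ring (this is what a blow-up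
with centre inside `V(g)` provides: the chart denominator generates the centre's ideal in the
chart, which contains `g`). Then, after rescaling the new generators by units
(`locAtCentre_adjoin_insert_mul_eq`), the new local ring is the local ring of a model `S[t′]`
with `q′ⁿ t′ ⊆ R₀` for some `q′ ∈ R₀` dividing a power of `q·g` in it (`q` the old tracking
element): `exists_model_tracked_of_denominators`. At the end of the construction the tracking
element divides a power of the monomial `f` and is therefore itself a unit times a monomial,
which is all that clause (c′) asks.

Everything is PROVED; no named facts, definitions, instances or notation are introduced.

## Sources

* V. Cossart, O. Piltant, J. Algebra 320 (2008) 1051–1082: Prop. 8.1 (1) and its proof (HAL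
  hal-00139124, p. 22). [CossartPiltant2008]
-/

noncomputable section

namespace Literature.AlgebraicGeometry.Resolution

universe u

open IsLocalRing Function

section DenominatorTracking

variable {S : Type u} [CommRing S] {E : Type u} [Field E] [Algebra S E]
  (O : ValuationSubring E) (R₀ : Subring E) (hSR₀ : ∀ s : S, algebraMap S E s ∈ R₀)

omit R₀ hSR₀ in
/-- The local ring of `S[insert z t]` depends on `t` only through the local ring of `S[t]`.
[cite: CossartPiltant2008, §2.1 (HAL pp. 8–9)] -/
theorem locAtCentre_adjoin_insert_congr {t t' : Set E} (z : E)
    (h : locAtCentre (Algebra.adjoin S t).toSubring O =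
      locAtCentre (Algebra.adjoin S t').toSubring O) :
    locAtCentre (Algebra.adjoin S (insert z t)).toSubring O =
      locAtCentre (Algebra.adjoin S (insert z t')).toSubring O := by
  have key : ∀ u : Set E, locAtCentre (Algebra.adjoin S (insert z u)).toSubring O =
      locAtCentre (Algebra.adjoin (locAtCentre (Algebra.adjoin S u).toSubring O) {z}).toSubring
        O := by
    intro u
    rw [locAtCentre_adjoin_locAtCentre_eq (Algebra.adjoin S u) O z, Set.union_singleton,
      Algebra.adjoin_insert_adjoin]
  rw [key t, key t', h]

include hSR₀ in
/-- **One new generator with controlled denominator.** Let `S[t]` be a model with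
`qⁿ t ⊆ R₀` (`S ⊆ R₀ ⊆ R_t`, `q ∈ R₀`), where the tracking element `q` divides a power of
`q₀ g` in an ambient ring `Ramb ⊇ R_{t ∪ {z}}` (`q₀ ∈ R₀` fixed). If `z = β/α` with
`α, β ∈ R_t`, `α ≠ 0`, and `α ∣ gᴹ` in `Ramb`, then the local ring of `S[insert z t]` is the
local ring of `S[insert z′ t]` for some `z′` (a rescaling of `z` by a unit) with
`q′ⁿ (insert z′ t) ⊆ R₀`, where `q′ ∈ R₀` again divides a power of `q₀ g` in `Ramb`.
[cite: CossartPiltant2008, Prop. 8.1 (1) and proof (HAL p. 22)] -/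
theorem exists_insert_tracked_of_denominator (t : Set E) (z : E)
    (hR₀R : R₀ ≤ locAtCentre (Algebra.adjoin S t).toSubring O) (Ramb : Subring E)
    (hamb : locAtCentre (Algebra.adjoin S (insert z t)).toSubring O ≤ Ramb)
    (q₀ g q : E) (hq₀ : q₀ ∈ R₀)
    (hq : q ∈ R₀) (hT : ∀ w ∈ t, ∃ n : ℕ, q ^ n * w ∈ R₀)
    (hqdiv : ∃ (N : ℕ) (c₀ : E), c₀ ∈ Ramb ∧ (q₀ * g) ^ N = q * c₀)
    (α β : E) (hα : α ∈ locAtCentre (Algebra.adjoin S t).toSubring O)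
    (hβ : β ∈ locAtCentre (Algebra.adjoin S t).toSubring O) (hα0 : α ≠ 0) (hz : z * α = β)
    (hdiv : ∃ (M : ℕ) (c : E), c ∈ Ramb ∧ g ^ M = α * c) :
    ∃ (z' q' : E), q' ∈ R₀ ∧
      locAtCentre (Algebra.adjoin S (insert z' t)).toSubring O =
        locAtCentre (Algebra.adjoin S (insert z t)).toSubring O ∧
      (∀ w ∈ insert z' t, ∃ n : ℕ, q' ^ n * w ∈ R₀) ∧
      ∃ (L : ℕ) (c' : E), c' ∈ Ramb ∧ (q₀ * g) ^ L = q' * c' := by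
  classical
  obtain ⟨yα, hyα, sα, hsα, hvsα, rfl⟩ := hα
  obtain ⟨yβ, hyβ, sβ, hsβ, hvsβ, rfl⟩ := hβ
  obtain ⟨N, c₀, hc₀, hN⟩ := hqdiv
  obtain ⟨M, c, hc, hM⟩ := hdiv
  have hsα0 : sα ≠ 0 := ne_zero_of_valuation_eq_one hvsα
  have hsβ0 : sβ ≠ 0 := ne_zero_of_valuation_eq_one hvsβ
  have hyα0 : yα ≠ 0 := by
    intro h; apply hα0; rw [h, zero_div]
  -- `q^m yα ∈ R₀`, `q^{m'} (yβ sα) ∈ R₀`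
  obtain ⟨m, hm⟩ := exists_pow_mul_mem_of_mem_adjoin R₀ hSR₀ hq t hT hyα
  obtain ⟨m', hm'⟩ := exists_pow_mul_mem_of_mem_adjoin R₀ hSR₀ hq t hT
    (Subalgebra.mul_mem _ hyβ hsα)
  -- the rescaled generator and the new tracking element
  have hzeq : z = yβ * sα / (sβ * yα) := by
    have : z = (yβ / sβ) / (yα / sα) := by
      rw [eq_div_iff (div_ne_zero hyα0 hsα0), hz]
    rw [this]
    field_simp
  set z' : E := z * sβ with hz'def
  have hz'eq : z' = yβ * sα / yα := by
    rw [hz'def, hzeq]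
    field_simp
  set q' : E := q * (q ^ m * yα) with hq'def
  have hq'R₀ : q' ∈ R₀ := R₀.mul_mem hq hm
  have hEq : locAtCentre (Algebra.adjoin S (insert z' t)).toSubring O =
      locAtCentre (Algebra.adjoin S (insert z t)).toSubring O :=
    locAtCentre_adjoin_insert_mul_eq t O z sβ hsβ hvsβ
  refine ⟨z', q', hq'R₀, hEq, ?_, ?_⟩
  · rintro w (rfl | hw)
    · -- `q'^{m'+1} z' = (q^m yα)^{m'} q^{m+1} (q^{m'} yβ sα) ∈ R₀`
      refine ⟨m' + 1, ?_⟩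
      have : q' ^ (m' + 1) * z' = (q ^ m * yα) ^ m' * q ^ (m + 1) * (q ^ m' * (yβ * sα)) := by
        rw [hz'eq, hq'def]
        field_simp
        ring
      rw [this]
      exact R₀.mul_mem (R₀.mul_mem (R₀.pow_mem hm _) (R₀.pow_mem hq _)) hm'
    · obtain ⟨n, hn⟩ := hT w hw
      refine ⟨n, ?_⟩
      have : q' ^ n * w = (q ^ m * yα) ^ n * (q ^ n * w) := by rw [hq'def]; ring
      rw [this]
      exact R₀.mul_mem (R₀.pow_mem hm _) hn
  · -- `(q₀ g)^{N(m+1)+M} = q' · (c₀^{m+1} q₀^M c / sα)`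
    have hsub : locAtCentre (Algebra.adjoin S t).toSubring O ≤ Ramb :=
      (locAtCentre_mono O (fun y hy => Algebra.adjoin_mono (Set.subset_insert _ _) hy)).trans
        hamb
    have hsαinv : sα⁻¹ ∈ Ramb := hsub (inv_mem_locAtCentre (le_locAtCentre _ _ hsα) hvsα)
    refine ⟨N * (m + 1) + M, c₀ ^ (m + 1) * q₀ ^ M * c * sα⁻¹,
      Subring.mul_mem _ (Subring.mul_mem _ (Subring.mul_mem _ (Subring.pow_mem _ hc₀ _)
        (Subring.pow_mem _ (hsub (hR₀R hq₀)) _)) hc) hsαinv, ?_⟩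
    have h1 : (q₀ * g) ^ (N * (m + 1) + M) = (q * c₀) ^ (m + 1) * q₀ ^ M * g ^ M := by
      rw [pow_add, pow_mul, hN]; ring
    rw [h1, hM, hq'def]
    field_simp
    ring

omit R₀ hSR₀ in
/-- The local ring of `S[t ∪ u]` depends on `t` only through the local ring of `S[t]`.
[cite: CossartPiltant2008, §2.1 (HAL pp. 8–9)] -/
theorem locAtCentre_adjoin_union_congr {t t' : Set E} (u : Set E)
    (h : locAtCentre (Algebra.adjoin S t).toSubring O =
      locAtCentre (Algebra.adjoin S t').toSubring O) :
    locAtCentre (Algebra.adjoin S (t ∪ u)).toSubring O =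
      locAtCentre (Algebra.adjoin S (t' ∪ u)).toSubring O := by
  have key : ∀ w : Set E, locAtCentre (Algebra.adjoin S (w ∪ u)).toSubring O =
      locAtCentre (Subring.closure
        ((locAtCentre (Algebra.adjoin S w).toSubring O : Set E) ∪ u)) O := by
    intro w
    rw [locAtCentre_closure_locAtCentre_union]
    congr 1
    rw [Algebra.adjoin_eq_ring_closure, Algebra.adjoin_eq_ring_closure, Subring.closure_union,
      Subring.closure_union, Subring.closure_union, Subring.closure_eq, Subring.closure_union,
      sup_assoc]
  rw [key t, key t', h]

include hSR₀ in
/-- **A step with controlled denominators keeps the model reading of [CoP1] Prop. 8.1 (1).**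
Let `S[t]` be a model with `qⁿ t ⊆ R₀` (`S ⊆ R₀ ⊆ R_t`, `q ∈ R₀` dividing a power of
`q₀ g` in an ambient ring `Ramb ⊇ R_{t ∪ P}`), and let `P` be finitely many new generators each
of which is `β/α` with `α, β ∈ R_t` and `α ∣ gᴹ` in `Ramb` (e.g. the chart coordinates of a
blow-up with centre inside `V(g)`, read in the new local ring). Then `R_{t ∪ P}` is the local
ring of a model `S[t′]`, `t ⊆ t′`, with `q′ⁿ t′ ⊆ R₀` for some `q′ ∈ R₀` dividing a power of
`q₀ g` in `Ramb`. [cite: CossartPiltant2008, Prop. 8.1 (1) and proof (HAL p. 22)] -/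
theorem exists_model_tracked_of_denominators (Ramb : Subring E) (q₀ g : E) (hq₀ : q₀ ∈ R₀)
    (P : Finset E) :
    ∀ (t : Set E) (_ : t.Finite) (_ : R₀ ≤ locAtCentre (Algebra.adjoin S t).toSubring O)
      (_ : locAtCentre (Algebra.adjoin S (t ∪ ↑P)).toSubring O ≤ Ramb)
      (q : E) (_ : q ∈ R₀) (_ : ∀ w ∈ t, ∃ n : ℕ, q ^ n * w ∈ R₀)
      (_ : ∃ (N : ℕ) (c₀ : E), c₀ ∈ Ramb ∧ (q₀ * g) ^ N = q * c₀)
      (_ : ∀ z ∈ P, ∃ α β : E, α ∈ locAtCentre (Algebra.adjoin S t).toSubring O ∧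
        β ∈ locAtCentre (Algebra.adjoin S t).toSubring O ∧ α ≠ 0 ∧ z * α = β ∧
        ∃ (M : ℕ) (c : E), c ∈ Ramb ∧ g ^ M = α * c),
    ∃ (t' : Set E), t ⊆ t' ∧ t'.Finite ∧
      locAtCentre (Algebra.adjoin S t').toSubring O =
        locAtCentre (Algebra.adjoin S (t ∪ ↑P)).toSubring O ∧
      ∃ q' : E, q' ∈ R₀ ∧ (∀ w ∈ t', ∃ n : ℕ, q' ^ n * w ∈ R₀) ∧
        ∃ (L : ℕ) (c' : E), c' ∈ Ramb ∧ (q₀ * g) ^ L = q' * c' := by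
  classical
  induction P using Finset.induction_on with
  | empty =>
    intro t ht hR₀R hamb q hq hT hqdiv hP
    exact ⟨t, le_rfl, ht, by rw [Finset.coe_empty, Set.union_empty], q, hq, hT, hqdiv⟩
  | insert z P₀ hzP₀ ih =>
    intro t ht hR₀R hamb q hq hT hqdiv hP
    -- first the generator `z`
    obtain ⟨α, β, hα, hβ, hα0, hz, hdiv⟩ := hP z (Finset.mem_insert_self _ _)
    have hamb₁ : locAtCentre (Algebra.adjoin S (insert z t)).toSubring O ≤ Ramb := by
      refine le_trans (locAtCentre_mono O (fun y hy => Algebra.adjoin_mono ?_ hy)) hamb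
      rw [Finset.coe_insert]
      intro w hw
      rcases hw with rfl | hw
      · exact Or.inr (Set.mem_insert _ _)
      · exact Or.inl hw
    obtain ⟨z', q', hq', hEq, hT', hqdiv'⟩ :=
      exists_insert_tracked_of_denominator O R₀ hSR₀ t z hR₀R Ramb hamb₁ q₀ g q hq₀ hq hT hqdiv
        α β hα hβ hα0 hz hdiv
    -- then the others, over `insert z' t`
    have hsub : locAtCentre (Algebra.adjoin S t).toSubring O ≤
        locAtCentre (Algebra.adjoin S (insert z' t)).toSubring O :=
      locAtCentre_mono O (fun y hy => Algebra.adjoin_mono (Set.subset_insert _ _) hy)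
    have hunion : locAtCentre (Algebra.adjoin S (insert z' t ∪ ↑P₀)).toSubring O =
        locAtCentre (Algebra.adjoin S (t ∪ ↑(insert z P₀))).toSubring O := by
      rw [locAtCentre_adjoin_union_congr O (↑P₀) hEq, Finset.coe_insert]
      congr 3
      ext w
      simp only [Set.mem_union, Set.mem_insert_iff]
      tauto
    obtain ⟨t'', ht't'', ht'', hEq'', q'', hq'', hT'', hqdiv''⟩ :=
      ih (insert z' t) (ht.insert z') (hR₀R.trans hsub) (hunion ▸ hamb) q' hq' hT' hqdiv'
        (fun w hw => by
          obtain ⟨α₁, β₁, hα₁, hβ₁, hα₁0, hw₁, hdiv₁⟩ := hP w (Finset.mem_insert_of_mem hw)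
          exact ⟨α₁, β₁, hsub hα₁, hsub hβ₁, hα₁0, hw₁, hdiv₁⟩)
    exact ⟨t'', (Set.subset_insert _ _).trans ht't'', ht'', hEq''.trans hunion, q'', hq'', hT'',
      hqdiv''⟩

/-! ### The same, confined to a subfield (for `t′ ⊆ K′` in the head of [CoP1] Prop. 9.3) -/

include hSR₀ in
/-- `exists_insert_tracked_of_denominator`, with the new generator confined to a subfield
`F ⊇ S ∪ t ∪ {z}`. [cite: CossartPiltant2008, Prop. 8.1 (1) and proof (HAL p. 22)] -/
theorem exists_insert_tracked_of_denominator_subset (t : Set E) (z : E)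
    (F : Subfield E) (hSF : ∀ s : S, algebraMap S E s ∈ F) (htF : t ⊆ F) (hzF : z ∈ F)
    (hR₀R : R₀ ≤ locAtCentre (Algebra.adjoin S t).toSubring O) (Ramb : Subring E)
    (hamb : locAtCentre (Algebra.adjoin S (insert z t)).toSubring O ≤ Ramb)
    (q₀ g q : E) (hq₀ : q₀ ∈ R₀)
    (hq : q ∈ R₀) (hT : ∀ w ∈ t, ∃ n : ℕ, q ^ n * w ∈ R₀)
    (hqdiv : ∃ (N : ℕ) (c₀ : E), c₀ ∈ Ramb ∧ (q₀ * g) ^ N = q * c₀)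
    (α β : E) (hα : α ∈ locAtCentre (Algebra.adjoin S t).toSubring O)
    (hβ : β ∈ locAtCentre (Algebra.adjoin S t).toSubring O) (hα0 : α ≠ 0) (hz : z * α = β)
    (hdiv : ∃ (M : ℕ) (c : E), c ∈ Ramb ∧ g ^ M = α * c) :
    ∃ (z' q' : E), z' ∈ F ∧ q' ∈ R₀ ∧
      locAtCentre (Algebra.adjoin S (insert z' t)).toSubring O =
        locAtCentre (Algebra.adjoin S (insert z t)).toSubring O ∧
      (∀ w ∈ insert z' t, ∃ n : ℕ, q' ^ n * w ∈ R₀) ∧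
      ∃ (L : ℕ) (c' : E), c' ∈ Ramb ∧ (q₀ * g) ^ L = q' * c' := by
  classical
  have hadjF : (Algebra.adjoin S t).toSubring ≤ F.toSubring := by
    let C : Subalgebra S E :=
      { F.toSubring with
        algebraMap_mem' := fun s => hSF s }
    have : Algebra.adjoin S t ≤ C := Algebra.adjoin_le htF
    exact fun y hy => this hy
  obtain ⟨yα, hyα, sα, hsα, hvsα, rfl⟩ := hα
  obtain ⟨yβ, hyβ, sβ, hsβ, hvsβ, rfl⟩ := hβ
  obtain ⟨N, c₀, hc₀, hN⟩ := hqdiv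
  obtain ⟨M, c, hc, hM⟩ := hdiv
  have hsα0 : sα ≠ 0 := ne_zero_of_valuation_eq_one hvsα
  have hsβ0 : sβ ≠ 0 := ne_zero_of_valuation_eq_one hvsβ
  have hyα0 : yα ≠ 0 := by
    intro h; apply hα0; rw [h, zero_div]
  -- `q^m yα ∈ R₀`, `q^{m'} (yβ sα) ∈ R₀`
  obtain ⟨m, hm⟩ := exists_pow_mul_mem_of_mem_adjoin R₀ hSR₀ hq t hT hyα
  obtain ⟨m', hm'⟩ := exists_pow_mul_mem_of_mem_adjoin R₀ hSR₀ hq t hT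
    (Subalgebra.mul_mem _ hyβ hsα)
  -- the rescaled generator and the new tracking element
  have hzeq : z = yβ * sα / (sβ * yα) := by
    have : z = (yβ / sβ) / (yα / sα) := by
      rw [eq_div_iff (div_ne_zero hyα0 hsα0), hz]
    rw [this]
    field_simp
  set z' : E := z * sβ with hz'def
  have hz'eq : z' = yβ * sα / yα := by
    rw [hz'def, hzeq]
    field_simp
  set q' : E := q * (q ^ m * yα) with hq'def
  have hq'R₀ : q' ∈ R₀ := R₀.mul_mem hq hm
  have hEq : locAtCentre (Algebra.adjoin S (insert z' t)).toSubring O =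
      locAtCentre (Algebra.adjoin S (insert z t)).toSubring O :=
    locAtCentre_adjoin_insert_mul_eq t O z sβ hsβ hvsβ
  refine ⟨z', q', F.mul_mem hzF (hadjF hsβ), hq'R₀, hEq, ?_, ?_⟩
  · rintro w (rfl | hw)
    · -- `q'^{m'+1} z' = (q^m yα)^{m'} q^{m+1} (q^{m'} yβ sα) ∈ R₀`
      refine ⟨m' + 1, ?_⟩
      have : q' ^ (m' + 1) * z' = (q ^ m * yα) ^ m' * q ^ (m + 1) * (q ^ m' * (yβ * sα)) := by
        rw [hz'eq, hq'def]
        field_simp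
        ring
      rw [this]
      exact R₀.mul_mem (R₀.mul_mem (R₀.pow_mem hm _) (R₀.pow_mem hq _)) hm'
    · obtain ⟨n, hn⟩ := hT w hw
      refine ⟨n, ?_⟩
      have : q' ^ n * w = (q ^ m * yα) ^ n * (q ^ n * w) := by rw [hq'def]; ring
      rw [this]
      exact R₀.mul_mem (R₀.pow_mem hm _) hn
  · -- `(q₀ g)^{N(m+1)+M} = q' · (c₀^{m+1} q₀^M c / sα)`
    have hsub : locAtCentre (Algebra.adjoin S t).toSubring O ≤ Ramb :=
      (locAtCentre_mono O (fun y hy => Algebra.adjoin_mono (Set.subset_insert _ _) hy)).trans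
        hamb
    have hsαinv : sα⁻¹ ∈ Ramb := hsub (inv_mem_locAtCentre (le_locAtCentre _ _ hsα) hvsα)
    refine ⟨N * (m + 1) + M, c₀ ^ (m + 1) * q₀ ^ M * c * sα⁻¹,
      Subring.mul_mem _ (Subring.mul_mem _ (Subring.mul_mem _ (Subring.pow_mem _ hc₀ _)
        (Subring.pow_mem _ (hsub (hR₀R hq₀)) _)) hc) hsαinv, ?_⟩
    have h1 : (q₀ * g) ^ (N * (m + 1) + M) = (q * c₀) ^ (m + 1) * q₀ ^ M * g ^ M := by
      rw [pow_add, pow_mul, hN]; ring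
    rw [h1, hM, hq'def]
    field_simp
    ring

include hSR₀ in
/-- `exists_model_tracked_of_denominators`, with the new generators confined to a subfield
`F ⊇ S ∪ t ∪ P`. [cite: CossartPiltant2008, Prop. 8.1 (1) and proof (HAL p. 22)] -/
theorem exists_model_tracked_of_denominators_subset (Ramb : Subring E) (q₀ g : E)
    (hq₀ : q₀ ∈ R₀) (F : Subfield E) (hSF : ∀ s : S, algebraMap S E s ∈ F) (P : Finset E) :
    ∀ (t : Set E) (_ : t.Finite) (_ : t ⊆ F) (_ : (↑P : Set E) ⊆ F)
      (_ : R₀ ≤ locAtCentre (Algebra.adjoin S t).toSubring O)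
      (_ : locAtCentre (Algebra.adjoin S (t ∪ ↑P)).toSubring O ≤ Ramb)
      (q : E) (_ : q ∈ R₀) (_ : ∀ w ∈ t, ∃ n : ℕ, q ^ n * w ∈ R₀)
      (_ : ∃ (N : ℕ) (c₀ : E), c₀ ∈ Ramb ∧ (q₀ * g) ^ N = q * c₀)
      (_ : ∀ z ∈ P, ∃ α β : E, α ∈ locAtCentre (Algebra.adjoin S t).toSubring O ∧
        β ∈ locAtCentre (Algebra.adjoin S t).toSubring O ∧ α ≠ 0 ∧ z * α = β ∧
        ∃ (M : ℕ) (c : E), c ∈ Ramb ∧ g ^ M = α * c),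
    ∃ (t' : Set E), t ⊆ t' ∧ t'.Finite ∧ t' ⊆ F ∧
      locAtCentre (Algebra.adjoin S t').toSubring O =
        locAtCentre (Algebra.adjoin S (t ∪ ↑P)).toSubring O ∧
      ∃ q' : E, q' ∈ R₀ ∧ (∀ w ∈ t', ∃ n : ℕ, q' ^ n * w ∈ R₀) ∧
        ∃ (L : ℕ) (c' : E), c' ∈ Ramb ∧ (q₀ * g) ^ L = q' * c' := by
  classical
  induction P using Finset.induction_on with
  | empty =>
    intro t ht htF hPF hR₀R hamb q hq hT hqdiv hP
    exact ⟨t, le_rfl, ht, htF, by rw [Finset.coe_empty, Set.union_empty], q, hq, hT, hqdiv⟩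
  | insert z P₀ hzP₀ ih =>
    intro t ht htF hPF hR₀R hamb q hq hT hqdiv hP
    have hzF : z ∈ F := hPF (by rw [Finset.coe_insert]; exact Set.mem_insert _ _)
    have hP₀F : (↑P₀ : Set E) ⊆ F := fun w hw =>
      hPF (by rw [Finset.coe_insert]; exact Set.mem_insert_of_mem _ hw)
    -- first the generator `z`
    obtain ⟨α, β, hα, hβ, hα0, hz, hdiv⟩ := hP z (Finset.mem_insert_self _ _)
    have hamb₁ : locAtCentre (Algebra.adjoin S (insert z t)).toSubring O ≤ Ramb := by
      refine le_trans (locAtCentre_mono O (fun y hy => Algebra.adjoin_mono ?_ hy)) hamb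
      rw [Finset.coe_insert]
      intro w hw
      rcases hw with rfl | hw
      · exact Or.inr (Set.mem_insert _ _)
      · exact Or.inl hw
    obtain ⟨z', q', hz'F, hq', hEq, hT', hqdiv'⟩ :=
      exists_insert_tracked_of_denominator_subset O R₀ hSR₀ t z F hSF htF hzF hR₀R Ramb hamb₁ q₀ g
        q hq₀ hq hT hqdiv α β hα hβ hα0 hz hdiv
    -- then the others, over `insert z' t`
    have hsub : locAtCentre (Algebra.adjoin S t).toSubring O ≤
        locAtCentre (Algebra.adjoin S (insert z' t)).toSubring O :=
      locAtCentre_mono O (fun y hy => Algebra.adjoin_mono (Set.subset_insert _ _) hy)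
    have hunion : locAtCentre (Algebra.adjoin S (insert z' t ∪ ↑P₀)).toSubring O =
        locAtCentre (Algebra.adjoin S (t ∪ ↑(insert z P₀))).toSubring O := by
      rw [locAtCentre_adjoin_union_congr O (↑P₀) hEq, Finset.coe_insert]
      congr 3
      ext w
      simp only [Set.mem_union, Set.mem_insert_iff]
      tauto
    obtain ⟨t'', ht't'', ht'', ht''F, hEq'', q'', hq'', hT'', hqdiv''⟩ :=
      ih (insert z' t) (ht.insert z') (Set.insert_subset hz'F htF) hP₀F (hR₀R.trans hsub)
        (hunion ▸ hamb) q' hq' hT' hqdiv'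
        (fun w hw => by
          obtain ⟨α₁, β₁, hα₁, hβ₁, hα₁0, hw₁, hdiv₁⟩ := hP w (Finset.mem_insert_of_mem hw)
          exact ⟨α₁, β₁, hsub hα₁, hsub hβ₁, hα₁0, hw₁, hdiv₁⟩)
    exact ⟨t'', (Set.subset_insert _ _).trans ht't'', ht'', ht''F, hEq''.trans hunion, q'', hq'',
      hT'', hqdiv''⟩

end DenominatorTracking

end Literature.AlgebraicGeometry.Resolution

end
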